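import Summits.ValiantsHypothesis.ValiantsHypothesis.Theorems.DivisionGapTriangularDimersDivisionEasyStubFaceLow
import Summits.ValiantsHypothesis.ValiantsHypothesis.Theorems.DivisionGapTriangularDimersDivisionEasyStubPmSum

/-!
# Crux `DivisionGap.TriangularDimersDivisionEasy` (stmt-ValiantsHypothesis-5067), line `Sketch` — registered stub `stub_faceIdentity`

THE FACE IDENTITY of the odd-join face lift: every monomial of the odd-join polynomial `oddJoin n` of the
`n × n` triangular rhombus has total degree `≥ n²`, and its degree-`n²` component is VERBATIM the crux's dimer
polynomial `Negative.triPM n` (`D_n = Σ_f Π_v x_(v, f v)` over fixed-point-free adjacent involutions).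

## Proof

Assembled from the two landed halves: `stub_oddJoinWeights` / `stub_faceCoeffLow` (`…StubFaceLow`: the
lowest component is the sum over perfect-matching edge sets `J` of `Π_{e ∈ J} y_e`) and `stub_pmSum`
(`…StubPmSum`: that sum is `triPM n`, by the bijection edge sets ↔ dimer involutions).  No `def` is declared.
-/

-- `Summit.ValiantsHypothesis.ValiantsHypothesis.…` is the tree's mandated single-conjunct layout (Sub = Summit).
set_option linter.dupNamespace false

namespace Summit.ValiantsHypothesis.ValiantsHypothesis.Theorems.TriangularDimersDivisionEasy.OddJoin

open scoped BigOperators NNReal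
open Finset MvPolynomial

noncomputable section

/-- **Registered stub `stub_faceIdentity`** (crux stmt-ValiantsHypothesis-5067, line `Sketch`): all monomials of
`oddJoin n` have degree `≥ n²`, and the degree-`n²` homogeneous component of `oddJoin n` is the crux's dimer
polynomial `Negative.triPM n`. [folklore] -/
theorem stub_faceIdentity (n : ℕ) :
    (∀ m ∈ (oddJoin n).support, n * n ≤ Finsupp.weight (fun _ => (1 : ℕ)) m) ∧
      weightedHomogeneousComponent (fun _ => (1 : ℕ)) (n * n) (oddJoin n) = Negative.triPM n :=
  ⟨stub_oddJoinWeights n, (stub_faceCoeffLow n).trans (stub_pmSum n)⟩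

end

end Summit.ValiantsHypothesis.ValiantsHypothesis.Theorems.TriangularDimersDivisionEasy.OddJoin
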